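import Summits.QuantumFields.YangMills.Theorems.VirialFluxGapFixSplitDefs
import HarnessLib

/-!
# Splitting the tree-gauged ring space at the two anchors: MEASURE PRESERVATION and equivariance
# (layer (B2) of the DIRECT Laplace road to ⟨stmt-QuantumFields-24204⟩ `VirialFluxGap.SharpTwistedLaplace`)

Helper module (free-hands work of width seat ym-line-sfw-p2-w3 g57, cell ym-idea-1; `--supports 24204`).  For the measurable splitting
✓`FixSplit.fixSplit : X_fix ≃ᵐ (SU2 × SU2) × FixRest` (anchors: seam site `y₀`, off-tree link `e₀`):
* `measurePreserving_insertAt` ∕ `measurePreserving_extract` — re-inserting ∕ extracting ONE coordinate of a finite product of copies of a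
  probability measure preserves measure (`(x, g) ↦ (i ↦ if i = a then x else g i)` checked on boxes with Mathlib `Measure.pi_eq`; the
  extraction is its inverse);
* `fixSplit_conj` — the splitting read on a conjugated configuration (definitional): the residual `SU(2)` acts diagonally on both sides;
* ★ `measurePreserving_fixSplit` — `fixSplit` carries `μ_fix = Haar^{off} ⊗ (⊗ configMeasure) ⊗ gaugeMeasure` to `(Haar ⊗ Haar) ⊗ restMeasure`
  (two extractions, then a reshuffle assembled from Mathlib `measurePreserving_prodAssoc` ∕ `measurePreserving_swap`).
This is the transport datum that moves the tensored chart identity (✓`ChartTensor`, ✓`AnchorChartMeasure`, ✓`ConjChart`) onto `X_fix` itself.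
Everything here is PROVED; no definitions, no named facts (namespace `Summit.QuantumFields.YangMills.Theorems.VirialFluxGap.FixSplit`).
HONEST FRAMING: measure-theoretic plumbing; ⟨24204⟩, ⟨24319⟩ and every rung stay OPEN; the Yang–Mills mass gap (Clay) is NOT touched; no summit is
proved by a line.

## References
* S. Helgason, *Groups and Geometric Analysis* (2000), Ch. I §1 Thm 1.14. [Helgason2000]
* G. E. Bredon, *Introduction to Compact Transformation Groups* (1972), Ch. II §§4–5. [Bredon1972]
-/

set_option autoImplicit false

noncomputable section

open MeasureTheory Set
open Literature.MathematicalPhysics.QuantumFieldTheory hiding SU2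
open Summit.QuantumFields.YangMills.Theorems.FemtoTransferGap
open Summit.QuantumFields.YangMills.Theorems.FemtoTransferGap.TT

namespace Summit.QuantumFields.YangMills.Theorems.VirialFluxGap.FixSplit



section Generic

variable {κ X : Type*} [MeasurableSpace X] [DecidableEq κ] [Fintype κ]

/-- **Re-inserting one coordinate preserves product probability measures**:
`(x, g) ↦ (i ↦ if i = a then x else g i)` pushes `μ ⊗ (⊗_{i ≠ a} μ)` to `⊗_κ μ` (checked on boxes, Mathlib `Measure.pi_eq`). [folklore] -/
theorem measurePreserving_insertAt (μ : Measure X) [IsProbabilityMeasure μ] (a : κ) :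
    MeasurePreserving (fun p : X × ({i : κ // ¬ i = a} → X) => fun i : κ => if h : i = a then p.1 else p.2 ⟨i, h⟩)
      (μ.prod (Measure.pi fun _ : {i : κ // ¬ i = a} => μ)) (Measure.pi fun _ : κ => μ) := by
  have hmeas : Measurable (fun p : X × ({i : κ // ¬ i = a} → X) => fun i : κ => if h : i = a then p.1 else p.2 ⟨i, h⟩) := by
    refine measurable_pi_lambda _ fun i => ?_
    by_cases h : i = a
    · simp only [h, dif_pos]; exact measurable_fst
    · simp only [h, dif_neg, not_false_eq_true]; exact (measurable_pi_apply _).comp measurable_snd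
  refine ⟨hmeas, ?_⟩
  symm
  refine Measure.pi_eq fun s hs => ?_
  rw [Measure.map_apply hmeas (MeasurableSet.univ_pi hs)]
  have hpre : (fun p : X × ({i : κ // ¬ i = a} → X) => fun i : κ => if h : i = a then p.1 else p.2 ⟨i, h⟩) ⁻¹' (Set.pi univ s) =
      s a ×ˢ Set.pi univ (fun i : {i : κ // ¬ i = a} => s i.1) := by
    ext ⟨x, g⟩
    simp only [Set.mem_preimage, Set.mem_univ_pi, Set.mem_prod]
    constructor
    · intro h
      refine ⟨by simpa using h a, fun i => ?_⟩
      have := h i.1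
      simp only [i.2, dif_neg, not_false_eq_true] at this
      exact this
    · rintro ⟨hx, hg⟩ i
      by_cases h : i = a
      · subst h; simpa using hx
      · simp only [h, dif_neg, not_false_eq_true]; exact hg ⟨i, h⟩
  rw [hpre, Measure.prod_prod, Measure.pi_pi, ← Fintype.prod_subtype_mul_prod_subtype (fun i : κ => i = a) (fun i : κ => μ (s i))]
  congr 1
  symm
  have key : ∀ t : Finset {i : κ // i = a}, (⟨a, rfl⟩ : {i : κ // i = a}) ∈ t → ∏ i ∈ t, μ (s ↑i) = μ (s a) := by
    intro t ht
    have : t = {⟨a, rfl⟩} := Finset.eq_singleton_iff_unique_mem.2 ⟨ht, fun j _ => Subtype.ext j.2⟩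
    rw [this, Finset.prod_singleton]
  exact key _ (@Finset.mem_univ _ (Subtype.fintype _) _)

/-- **Extracting one coordinate preserves product probability measures**: `f ↦ (f a, f|_{i ≠ a})` pushes `⊗_κ μ` to `μ ⊗ (⊗_{i ≠ a} μ)`.
[folklore] -/
theorem measurePreserving_extract (μ : Measure X) [IsProbabilityMeasure μ] (a : κ) :
    MeasurePreserving (fun f : κ → X => (f a, fun i : {i : κ // ¬ i = a} => f i.1)) (Measure.pi fun _ : κ => μ)
      (μ.prod (Measure.pi fun _ : {i : κ // ¬ i = a} => μ)) := by
  -- the extraction is the inverse of the insertion, as a measurable equivalence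
  set e : (X × ({i : κ // ¬ i = a} → X)) ≃ᵐ (κ → X) :=
    { toFun := fun p i => if h : i = a then p.1 else p.2 ⟨i, h⟩
      invFun := fun f => (f a, fun i => f i.1)
      left_inv := by
        rintro ⟨x, g⟩
        refine Prod.ext (by simp) ?_
        funext i; simp [i.2]
      right_inv := by
        intro f; funext i
        by_cases h : i = a
        · subst h; simp
        · simp [h]
      measurable_toFun := (measurePreserving_insertAt μ a).measurable
      measurable_invFun := (measurable_pi_apply a).prodMk (measurable_pi_lambda _ fun i => measurable_pi_apply i.1) }
    with he
  have h := (measurePreserving_insertAt (κ := κ) μ a).symm e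
  exact h

end Generic

variable {L : ℕ} [NeZero L]

omit [NeZero L] in
/-- The splitting read on a conjugated configuration: `fixSplit (k·x) = ((k c k⁻¹, k n k⁻¹), k·rest)` (definitional). [folklore] -/
theorem fixSplit_conj (e₀ : OffIdx L) (y₀ : Site 3 L) (k : SU2) (x : FixSpace L) :
    fixSplit L e₀ y₀ (((fun i => k * x.1 i * k⁻¹),
      ((fun j => gaugeTransform (fun _ : Site 3 L => k) (x.2.1 j)), (fun y => k * x.2.2 y * k⁻¹))) : FixSpace L) =
      ((k * x.2.2 y₀ * k⁻¹, k * x.1 e₀ * k⁻¹),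
        ((fun i => k * x.1 i.1 * k⁻¹), ((fun j => gaugeTransform (fun _ : Site 3 L => k) (x.2.1 j)), (fun y => k * x.2.2 y.1 * k⁻¹)))) :=
  rfl

/-- ★ **The splitting preserves measure**: `fixSplit` carries `μ_fix = Haar^{off} ⊗ (⊗ configMeasure) ⊗ gaugeMeasure` to
`(Haar ⊗ Haar) ⊗ restMeasure`. [cite: Helgason2000, Ch. I §1 Thm 1.14] -/
theorem measurePreserving_fixSplit (e₀ : OffIdx L) (y₀ : Site 3 L) :
    MeasurePreserving (fixSplit L e₀ y₀)
      ((Measure.pi fun _ : OffIdx L => haarProbability SU2).prod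
        ((Measure.pi fun _ : Fin (2 * L - 1) => configMeasure SU2 L).prod (gaugeMeasure L)))
      (((haarProbability SU2).prod (haarProbability SU2)).prod (restMeasure L e₀ y₀)) := by
  classical
  haveI : IsProbabilityMeasure (gaugeMeasure L) := by unfold gaugeMeasure; infer_instance
  set η : Measure SU2 := haarProbability SU2 with hη
  set ρ₁ : Measure ({i : OffIdx L // ¬ i = e₀} → SU2) := Measure.pi fun _ => haarProbability SU2 with hρ₁
  set φ : Measure (Fin (2 * L - 1) → GaugeConfig 3 L SU2) := Measure.pi fun _ => configMeasure SU2 L with hφ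
  set ρ₃ : Measure ({y : Site 3 L // ¬ y = y₀} → SU2) := Measure.pi fun _ => haarProbability SU2 with hρ₃
  -- step 1: extract the two anchor coordinates
  have hA : MeasurePreserving (fun f : OffIdx L → SU2 => (f e₀, fun i : {i : OffIdx L // ¬ i = e₀} => f i.1))
      (Measure.pi fun _ : OffIdx L => haarProbability SU2) (η.prod ρ₁) := measurePreserving_extract (haarProbability SU2) e₀
  have hB : MeasurePreserving (fun g : Site 3 L → SU2 => (g y₀, fun y : {y : Site 3 L // ¬ y = y₀} => g y.1)) (gaugeMeasure L)
      (η.prod ρ₃) := by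
    unfold gaugeMeasure; exact measurePreserving_extract (haarProbability SU2) y₀
  have h1 := hA.prod ((MeasurePreserving.id φ).prod hB)
  -- step 2: the reshuffle `((n, r₁), (f, (c, r₃))) ↦ ((c, n), (r₁, (f, r₃)))`, from primitive measure-preserving moves
  have q1 : MeasurePreserving (fun p : (Fin (2 * L - 1) → GaugeConfig 3 L SU2) × (SU2 × ({y : Site 3 L // ¬ y = y₀} → SU2)) =>
      (p.2.1, (p.1, p.2.2))) (φ.prod (η.prod ρ₃)) (η.prod (φ.prod ρ₃)) :=
    (measurePreserving_prodAssoc η φ ρ₃).comp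
      (((Measure.measurePreserving_swap (μ := φ) (ν := η)).prod (MeasurePreserving.id ρ₃)).comp
        (measurePreserving_prodAssoc φ η ρ₃).symm)
  have q2 : MeasurePreserving
      (fun p : ({i : OffIdx L // ¬ i = e₀} → SU2) × (SU2 × ((Fin (2 * L - 1) → GaugeConfig 3 L SU2) × ({y : Site 3 L // ¬ y = y₀} → SU2))) =>
        (p.2.1, (p.1, p.2.2))) (ρ₁.prod (η.prod (φ.prod ρ₃))) (η.prod (ρ₁.prod (φ.prod ρ₃))) :=
    (measurePreserving_prodAssoc η ρ₁ (φ.prod ρ₃)).comp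
      (((Measure.measurePreserving_swap (μ := ρ₁) (ν := η)).prod (MeasurePreserving.id (φ.prod ρ₃))).comp
        (measurePreserving_prodAssoc ρ₁ η (φ.prod ρ₃)).symm)
  have q3 : MeasurePreserving
      (fun p : SU2 × (SU2 × (({i : OffIdx L // ¬ i = e₀} → SU2) × ((Fin (2 * L - 1) → GaugeConfig 3 L SU2) ×
        ({y : Site 3 L // ¬ y = y₀} → SU2)))) => ((p.2.1, p.1), p.2.2))
      (η.prod (η.prod (ρ₁.prod (φ.prod ρ₃)))) ((η.prod η).prod (ρ₁.prod (φ.prod ρ₃))) :=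
    ((Measure.measurePreserving_swap (μ := η) (ν := η)).prod (MeasurePreserving.id (ρ₁.prod (φ.prod ρ₃)))).comp
      (measurePreserving_prodAssoc η η (ρ₁.prod (φ.prod ρ₃))).symm
  -- assemble: fixSplit = q3 ∘ (id × q2) ∘ (id × (id × q1)) ∘ prodAssoc ∘ h1-map
  have h2 := (measurePreserving_prodAssoc η ρ₁ (φ.prod (η.prod ρ₃))).comp h1
  have h3 := ((MeasurePreserving.id η).prod ((MeasurePreserving.id ρ₁).prod q1)).comp h2
  have h4 := ((MeasurePreserving.id η).prod q2).comp h3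
  have h5 := q3.comp h4
  exact h5

end Summit.QuantumFields.YangMills.Theorems.VirialFluxGap.FixSplit

end
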